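import Summits.CriticalPhenomena.PercolationContinuityZ3.Theorems.Transplant.PlanarSkeletonFrmFromDefs
import Summits.CriticalPhenomena.PercolationContinuityZ3.Theorems.Transplant.SkelFrmFromBParamsFaceCountsYA
import Summits.CriticalPhenomena.PercolationContinuityZ3.Theorems.Transplant.SkelFrmBParamsFaceCountsYA
import Summits.CriticalPhenomena.PercolationContinuityZ3.Theorems.Transplant.SkelFrmBParamsFaceCountsW
import HarnessLib
import Summits.CriticalPhenomena.PercolationContinuityZ3.Theorems.Transplant.SkelFrmBParamsFaceCountsWY
/-!
# U-WAVE PORT (RULING D-U, lead g21 2026-08-26; WAVE-U-MANIFEST v3.1 row «SkelFrmBParamsFaceCountsWY» ↦ «SkelFrmFromBParamsFaceCountsWY») of the tree module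
# `Transplant/SkelFrmBParamsFaceCountsWY` onto the carrier `PlanarSkeletonFrmFrom` (frames only, cylinders connected from width `ℓ₀` on)

ORIGINAL TITLE: N2 (frames-only node, OPEN) — (F) column under (R-44)(c): **THE ONE-SIDED TANGENTIAL COUNT OF THE y′-FACE ROUTE** (`σT := 1`, window landing)

builds on p205010 (kernel theorem, internal audit signed; external expert review pending) — nothing in this file uses p205010; NOTHING is claimed about the
OPEN node U `SamePDropOfSkeletonFrmFrom₁` (nor U_s / the end state).  Lane `prim-bschramm`, seat `prim-bschramm-stmt` gen 26 (port pen, RULING M-11 family P-stmt; tool = p3-g26's port_u.py of record, registry-driven inputs); helper file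
(`--supports stmt-CriticalPhenomena-4575 --as helper`).  PORT RULES r1–r4 of RULING D-U: declaration order and proof texts are those of the original,
byte-identical except (i) the carrier token `PlanarSkeletonFrm ↦ PlanarSkeletonFrmFrom` (binders, `namespace`/`end` lines, qualified names of twinned
declarations), (ii) carrier-FREE declarations of the original (φ-level `Skelφ…` blocks and namespace-only arithmetic residents) are NOT re-declared —
this file imports the original and `export`s the twin-free residents (POLICY T / treatment (m1)); residents whose statement mentions a twinned
constant are copied, (iii) every carrier-binding declaration keeps its explicit binder `(Φ : PlanarSkeletonFrmFrom G)` in its own signature (r2).  Docstrings and citations are the original's.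
-/

noncomputable section

open scoped Classical

namespace Summit.CriticalPhenomena.PercolationContinuityZ3.Theorems.Transplant

namespace PlanarSkeletonFrmFrom

namespace NegB

open Literature.Probability.Percolation Literature.Probability.LatticeModels SimpleGraph
open Literature.Probability.Percolation.KozmaNitzan.Cells (oth sgOf sgOf_sign)
open SkelConc (Consts)
open Skelφ.StepI (DataNS)
open Neg

namespace KS

variable (κ : Consts) {V : Type} [DecidableEq V] [Countable V] {G : SimpleGraph V} [G.LocallyFinite] (Φ : PlanarSkeletonFrmFrom G) (t : V)
  (p : unitInterval) (D : DataNS V) (g f : ℕ)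

/-- **The one-sided tangential count of the y′-face route** (window half-width `bw`): forward x-strides after the forced first one. [this work] -/
def N3WY (κ : Consts) {V : Type} [DecidableEq V] [Countable V] {G : SimpleGraph V} [G.LocallyFinite] (Φ : PlanarSkeletonFrmFrom G) (t : V) (p : unitInterval) (D : DataNS V) (g : ℕ) (f : ℕ) (P : PCells2T) (yL x : Site 2) (du : MDir) (z : Site 2) (bw : ℕ) : ℕ :=
  Skelφ.fwdCount (T0Y P x du z) (FcA κ Φ t p D g f yL + u₀A κ Φ t p D g f) (u₀A κ Φ t p D g f).toNat bw

/-- **The one-sided count's spec in `N3Y_spec`'s shape** (sign `1`): the stride budget `u₀·(N+1) ≤ |T0Y − FcA| + 2u₀` and the WINDOW landing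
`T0Y − bw ≤ FcA + 1·u₀·(N+1) ≤ T0Y + bw`, from `u₀ ≤ 2bw` and the forward-bounded start `FcA + u₀ ≤ T0Y + bw`.
[cite: KozmaNitzan2024, §4 Lemma 12 (pp. 23–25)] -/
theorem N3WY_spec (κ : Consts) {V : Type} [DecidableEq V] [Countable V] {G : SimpleGraph V} [G.LocallyFinite] (Φ : PlanarSkeletonFrmFrom G) (t : V) (p : unitInterval) (D : DataNS V) (g : ℕ) (f : ℕ) (P : PCells2T) (yL x : Site 2) (du : MDir) (z : Site 2) {bw : ℕ} (hbw : u₀A κ Φ t p D g f ≤ 2 * (bw : ℤ))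
    (hF : FcA κ Φ t p D g f yL + u₀A κ Φ t p D g f ≤ T0Y P x du z + bw) :
    u₀A κ Φ t p D g f * ((N3WY κ Φ t p D g f P yL x du z bw : ℤ) + 1) ≤ |T0Y P x du z - FcA κ Φ t p D g f yL| + 2 * u₀A κ Φ t p D g f ∧
      T0Y P x du z - bw ≤ FcA κ Φ t p D g f yL + 1 * u₀A κ Φ t p D g f * ((N3WY κ Φ t p D g f P yL x du z bw : ℤ) + 1) ∧
      FcA κ Φ t p D g f yL + 1 * u₀A κ Φ t p D g f * ((N3WY κ Φ t p D g f P yL x du z bw : ℤ) + 1) ≤ T0Y P x du z + bw := by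
  have hu : 1 ≤ u₀A κ Φ t p D g f := (units_eqA κ Φ t p D g f).2.2.2.2.1
  set u := u₀A κ Φ t p D g f with hu_def
  set T := T0Y P x du z
  set F := FcA κ Φ t p D g f yL
  have hun : ((u.toNat : ℕ) : ℤ) = u := Int.toNat_of_nonneg (by linarith)
  have hu0 : 0 < u.toNat := by omega
  have key := Skelφ.fwdCount_spec (T := T) (F := F + u) (bw := bw) hu0 (by rw [hun]; exact hbw) hF
  have up := Skelφ.mul_fwdCount_lt (T := T) (F := F + u) (bw := bw) hu0
  rw [hun] at key up
  have hN : (N3WY κ Φ t p D g f P yL x du z bw : ℤ) = (Skelφ.fwdCount T (F + u) u.toNat bw : ℤ) := rfl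
  rw [hN]
  set N : ℤ := (Skelφ.fwdCount T (F + u) u.toNat bw : ℤ)
  have hN0 : 0 ≤ N := by positivity
  refine ⟨?_, by linarith [key.1], by linarith [key.2]⟩
  -- budget: either no stride beyond the forced one, or the strides stop before the near edge plus one stride
  rcases le_max_iff.1 up with h | h
  · have : u * N ≤ 0 := by linarith
    have hN' : N = 0 := le_antisymm (by nlinarith) hN0
    rw [hN']; linarith [abs_nonneg (T - F)]
  · have hTF : T - F ≤ |T - F| := le_abs_self _
    nlinarith

end KS

end NegB

end PlanarSkeletonFrmFrom

end Summit.CriticalPhenomena.PercolationContinuityZ3.Theorems.Transplant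

end
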